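import Literature.NumberTheory.DiophantineGeometry.GenEllProjLine
import Literature.NumberTheory.Transcendental.QuadraticRelationsLogarithmsSec3Heights
import HarnessLib

/-!
# Points of `ℙ¹(Q̄)` on a fixed divisor have bounded height ([GenEll] Thm. 2.1, proof: the exceptional
# finite sets)

S. Mochizuki, *Arithmetic elliptic curves in general position*, Math. J. Okayama Univ. 52 (2010)
[cite: MochizukiGenEll2010, Thm 2.1 pp.11–13]. Every transfer step in the proof of Thm. 2.1 discards
a FINITE set of points of the curve (the ramification / cusp preimages `φ⁻¹(C)`, "inequalities that
hold after possibly omitting finitely many points"); in the bounded-discrepancy formalism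
(`GenEllBDClasses.BDLe`: `α ≤ β + O(1)` on a set of presented points) such a set is harmless as soon as
`ht` is BOUNDED on it. In the tree's presentation of points (`GenEllProjLine.NFPoint = (F, x)`) the set
of presentations of finitely many algebraic numbers is not finite, so the bound must be proved
uniformly in the presentation. This file PROVES it: the roots `x` of a fixed nonzero `m ∈ ℤ[t]`
satisfy `ht(F, x) ≤ H(m)` for every presentation (`NFPoint.exists_ht_le_of_aeval_eq_zero`), via the
monic relation for `a·x` (`a` the leading coefficient) and the tree's root bound
`RoyWaldschmidt1997.logHeight₁_root_le_of_monic` (Nesterenko–Philippon Lemma 2.8), plus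
`logHeight₁_intCast_le` (`h_F(b) ≤ [F:ℚ] log(|b|+1)` for `b ∈ ℤ`). Classical; abc-iut cell, route item
GenEllTwo (stmt-ABC-19679), work package W2; nothing here bears on [IUTchIII] Cor. 3.12.
-/

noncomputable section

open NumberField Height Polynomial

namespace Literature.NumberTheory.DiophantineGeometry.GenEll

namespace NFPoint

/-- `h_F(b) ≤ [F:ℚ]·log(|b| + 1)` for an integer `b` in a number field `F` (relative height of a
rational integer: `H_F(b) = |b|^{[F:ℚ]}` for `b ≠ 0`; Silverman AEC VIII.5.4 (b) with `P = (b : 1)`).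
[cite: SilvermanAEC2009, Prop VIII.5.4 (b)] -/
theorem logHeight₁_intCast_le {F : Type*} [Field F] [NumberField F] (b : ℤ) :
    logHeight₁ (b : F) ≤ Module.finrank ℚ F * Real.log (|(b : ℝ)| + 1) := by
  rcases eq_or_ne b 0 with rfl | hb
  · simp only [Int.cast_zero, logHeight₁_zero, abs_zero, zero_add, Real.log_one, mul_zero, le_refl]
  · have hn : b.natAbs ≠ 0 := Int.natAbs_ne_zero.mpr hb
    have h1 : logHeight₁ (b : F) = logHeight₁ ((b.natAbs : ℕ) : F) := by
      rcases Int.natAbs_eq b with h | h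
      · conv_lhs => rw [h]
        rw [Int.cast_natCast]
      · conv_lhs => rw [h]
        rw [Int.cast_neg, Int.cast_natCast, logHeight₁_neg]
    have h2 : logHeight₁ ((b.natAbs : ℕ) : F) ≤ totalWeight F * Real.log b.natAbs := by
      rw [logHeight₁_eq_log_mulHeight₁]
      calc Real.log (mulHeight₁ ((b.natAbs : ℕ) : F))
          ≤ Real.log ((b.natAbs : ℝ) ^ totalWeight F) :=
            Real.log_le_log (mulHeight₁_pos _)
              (Literature.NumberTheory.Transcendental.mulHeight₁_natCast_le _ hn)
        _ = totalWeight F * Real.log b.natAbs := Real.log_pow _ _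
    have h3 : Real.log (b.natAbs : ℝ) ≤ Real.log (|(b : ℝ)| + 1) := by
      rw [Nat.cast_natAbs, Int.cast_abs]
      exact Real.log_le_log (abs_pos.mpr (Int.cast_ne_zero.mpr hb)) (by linarith [abs_nonneg (b : ℝ)])
    rw [NumberField.totalWeight_eq_finrank] at h2
    calc logHeight₁ (b : F) ≤ Module.finrank ℚ F * Real.log b.natAbs := h1.trans_le h2
      _ ≤ Module.finrank ℚ F * Real.log (|(b : ℝ)| + 1) :=
          mul_le_mul_of_nonneg_left h3 (Nat.cast_nonneg _)

/-- **The points of `ℙ¹(Q̄)` on a fixed divisor `V(m)`, `m ∈ ℤ[t] ∖ {0}`, have bounded absolute height**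
(they are finitely many algebraic numbers): if `m(x) = 0` then `ht(x) ≤ H(m)` uniformly in the
presentation. Proof: `y = a·x` (`a` the leading coefficient) satisfies a monic integer relation of
degree `deg m`, so `h(y) ≤ [F:ℚ](log deg m + Σ log(|b_k|+1))` (the tree's
`logHeight₁_root_le_of_monic`), and `h(x) ≤ h(a) + h(y)`. This is the finiteness/boundedness used at
each "possibly omitting finitely many points" of [GenEll] Thm. 2.1's proof ([GenEll] Prop. 1.4 (iv),
Northcott, in the trivial direction). [cite: MochizukiGenEll2010, Prop 1.4 (iv) p.6] -/
theorem exists_ht_le_of_aeval_eq_zero (m : ℤ[X]) (hm : m ≠ 0) :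
    ∃ H : ℝ, ∀ P : NFPoint, aeval P.x m = 0 → P.ht ≤ H := by
  classical
  set D := m.natDegree with hD
  set a : ℤ := m.leadingCoeff with ha
  have ha0 : a ≠ 0 := leadingCoeff_ne_zero.mpr hm
  set b : ℕ → ℤ := fun k => m.coeff k * a ^ (D - 1 - k) with hb
  refine ⟨Real.log D + ∑ k ∈ Finset.range D, Real.log (|(b k : ℝ)| + 1) +
    Real.log (|(a : ℝ)| + 1), fun P hP => ?_⟩
  rcases Nat.eq_zero_or_pos D with hD0 | hDpos
  · -- degree `0`: `m = C a` has no roots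
    exfalso
    have hnd : m.natDegree = 0 := by rw [← hD]; exact hD0
    have hcoeff : m.coeff 0 = a := by rw [ha, leadingCoeff, hnd]
    have hmC : m = C a := by rw [← hcoeff]; exact eq_C_of_natDegree_eq_zero hnd
    rw [hmC, aeval_C, algebraMap_int_eq, eq_intCast] at hP
    exact (Int.cast_ne_zero.mpr ha0) hP
  · set x := P.x with hx
    have haF : (a : P.F) ≠ 0 := Int.cast_ne_zero.mpr ha0
    set y : P.F := (a : P.F) * x with hy
    -- the monic relation for `y`
    have h0 : ∑ i ∈ Finset.range (D + 1), (m.coeff i : P.F) * x ^ i = 0 := by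
      have h := hP
      rw [aeval_eq_sum_range] at h
      simpa only [zsmul_eq_mul] using h
    have hrel : y ^ D + ∑ k ∈ Finset.range D, (b k : P.F) * y ^ k = 0 := by
      have h1 : (a : P.F) ^ (D - 1) * ∑ i ∈ Finset.range (D + 1), (m.coeff i : P.F) * x ^ i = 0 := by
        rw [h0, mul_zero]
      rw [Finset.sum_range_succ, mul_add, Finset.mul_sum] at h1
      have hlead : (m.coeff D : P.F) = a := by rw [ha, hD, coeff_natDegree]
      have htop : (a : P.F) ^ (D - 1) * ((m.coeff D : P.F) * x ^ D) = y ^ D := by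
        rw [hlead, hy, mul_pow, ← mul_assoc, ← pow_succ, Nat.sub_add_cancel hDpos]
      have hlow : ∀ i ∈ Finset.range D,
          (a : P.F) ^ (D - 1) * ((m.coeff i : P.F) * x ^ i) = (b i : P.F) * y ^ i := by
        intro i hi
        have hi' : i ≤ D - 1 := by
          have := Finset.mem_range.mp hi
          omega
        simp only [hb, hy]
        push_cast
        rw [mul_pow, ← pow_sub_mul_pow (a : P.F) hi']
        ring
      rw [htop, Finset.sum_congr rfl hlow, add_comm] at h1
      exact h1
    -- height of `y`
    have hyle := Literature.NumberTheory.Transcendental.RoyWaldschmidt1997.logHeight₁_root_le_of_monic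
      hDpos (fun k => (b k : P.F)) hrel
    rw [NumberField.totalWeight_eq_finrank] at hyle
    have hbk : ∑ k ∈ Finset.range D, logHeight₁ ((b k : ℤ) : P.F) ≤
        Module.finrank ℚ P.F * ∑ k ∈ Finset.range D, Real.log (|(b k : ℝ)| + 1) := by
      rw [Finset.mul_sum]
      exact Finset.sum_le_sum fun k _ => logHeight₁_intCast_le (b k)
    -- height of `x = a⁻¹ y`
    have hxy : x = (a : P.F)⁻¹ * y := by rw [hy, ← mul_assoc, inv_mul_cancel₀ haF, one_mul]
    have hxle : logHeight₁ x ≤ logHeight₁ (a : P.F) + logHeight₁ y := by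
      rw [hxy]
      exact (logHeight₁_mul_le _ _).trans (by rw [logHeight₁_inv])
    have hale := logHeight₁_intCast_le (F := P.F) a
    have hdeg : (0 : ℝ) < P.degree := Nat.cast_pos.mpr P.degree_pos
    have hdeg' : (Module.finrank ℚ P.F : ℝ) = P.degree := rfl
    rw [hdeg'] at hyle hbk hale
    unfold ht
    rw [← hx, inv_mul_le_iff₀ hdeg]
    have : logHeight₁ x ≤ P.degree * (Real.log D + ∑ k ∈ Finset.range D, Real.log (|(b k : ℝ)| + 1) +
        Real.log (|(a : ℝ)| + 1)) := by nlinarith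
    linarith

end NFPoint

end Literature.NumberTheory.DiophantineGeometry.GenEll

end
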